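import Mathlib
import Summits.Ventures.HodgeRepro2.LevelPositivity
import Summits.Ventures.HodgeRepro2.LevelSufficientlySmall
import Summits.Ventures.HodgeRepro2.LiuOscillator
import Summits.Ventures.HodgeRepro2.T6B5Data
import Summits.Ventures.HodgeRepro2.T6B5Datum

/-!
# T6B5Hyp — Tier 6, sub-goal B5: the displayed published hypotheses (README §10.2; TARGET-T6.md §3 row H13, §7(c))

Two displays, each a `def … : Prop` in the free parameter `𝓛 : LiuAlbaneseDatum K c χEF` (the representation-level
carriers of `T6B5Datum.lean`), carrying the printed statement verbatim with its locator. Liu's Prop. 4.13 / Thm. 4.18 /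
Cor. 4.20 are NOT displayed here: they are t6-p6's displays (`T6B3Hyp.lean`, predicates of p2's
`Liu.AlbaneseH1Shape`, ruling R5), consumed by B5 at the shape `shapeOf 𝓛 …` that the carriers build. Statement
lane: definitions and `#check` only. Journal page layer `paper:liu2021-fourier-jacobi-cycles-arithmetic-relative-
trace-formula` (Y. Liu, Cambridge J. Math. 9 (2021), no. 1, 1–147; `p00NN` = journal page NN, `l.` = layer line).
README §8(d): uses an L-value-free non-vanishing device: NO.
-/

namespace Summit.Ventures.HodgeRepro2.T6.Hyp

open Summit.Ventures.HodgeRepro2.LevelPositivity Summit.Ventures.HodgeRepro2.ShimuraData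
  Summit.Ventures.HodgeRepro2.T6.B5Data Summit.Ventures.HodgeRepro2.T6.B5Datum

universe u

variable {K : Type u} [Field K] [NumberField K] [NumberField.IsCMField K] {c : Liu.IdeleConjugation K}
  {χEF : Liu.QuadraticCharacter K c}

/-- [cite: Liu2021, the paragraph following Definition 4.11 (the definition of ω(μ, ε, χ)), Cambridge J. Math. 9
(2021) p. 46 ll. 50–61, layer paper:liu2021-fourier-jacobi-cycles-arithmetic-relative-trace-formula p0046 ll. 50–61] «For an adèlic oscillator triple (μ, ε, χ),
the local oscillator representation ω(μv , εv , χv ) of G(Fv ) introduced in Subsection D.1 is unramiﬁed for all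
but ﬁnitely many v. Thus, it makes sense to deﬁne the adèlic oscillator representation attached to (μ, ε, χ)»
‹ω(μ, ε, χ) := ⊗′_v ω(μ_v, ε_v, χ_v),› (the display, layer ll. 56–58 in reading order; the prime of the restricted
tensor product ⊗′ restored from the arXiv TeX layer paper:arxiv-2102.11518 p0020 l. 40, the page layer printing it as
the glyph codes 0x0f / 0x02) «which is an irreducible
admissible representation of G(A∞F ).» (layer ll. 60–61; «A∞F» = A_F^∞ with the layer's displaced sub/superscript)
[display: the asserted property of the carried representation `𝓛.ω (𝓛.osc t)` = ω(μ, ε, χ), for every adèlic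
oscillator triple `t : Liu.OscillatorTriple K c χEF` (the cell's concrete Def. 4.11 triples, p2's LiuOscillator.lean):
«irreducible» = Mathlib's `Representation.IsIrreducible` (no proper non-zero subrepresentation; non-zero by
definition), «admissible» = Getz–Hahn GTM 300 Def. 5.4 via Def. 5.3 (`B5Data.IsAdmissible`: open stabilisers,
finite-dimensional `K`-invariants for every compact open `K`); the restricted tensor product `⊗_v` and the local
factors are the definition of the carrier, not a property, and are not carried — FAITHFUL for the asserted
property] [quote-audit: QA-t6lit-12] -/
def Liu2021_Def4_11 (𝓛 : LiuAlbaneseDatum K c χEF) : Prop :=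
  ∀ t : Liu.OscillatorTriple K c χEF, (𝓛.ω (𝓛.osc t)).IsIrreducible ∧ IsAdmissible (𝓛.ω (𝓛.osc t))

/-- [cite: UllmoYafaev2014, §2, proof of Lemma 2.2, recalled with reference to [Pi] sec. 0.6 (E. Ullmo, A. Yafaev,
Galois orbits and equidistribution of special subvarieties: towards the André–Oort conjecture, Ann. of Math. (2) 180
(2014), no. 3, 823–865; Ann. of Math. print NOT HELD — cite-class: author-copy), layer paper:arxiv-1209.0934 p0007
ll. 44–47] «any compact open subgroup K of G(A_f) contains a
neat compact open subgroup K' of finite index (see [Pi] sec. 0.6)» [the same sentence: C. Daw, The André–Oort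
conjecture via o-minimality, LMS Lecture Note Ser. 421 (2015), §13, layer paper:arxiv-1412.3237 p0014 l. 8:
«Every compact open subgroup K of G(A_f) contains a neat compact open subgroup K' with finite index.»]
[display: G(A_f) = the finite-adèlic points of the ℚ-group G(τ) = Res_{F/ℚ} U(V(τ)), identified with G(A_F^∞)
by Liu's fixed isomorphism (p0109 ll. 11–17; TIER4 §B5 Lemma B5.8 (N2)); «neat» = the carried elementwise
predicate `𝓛.neat` (BMM 2016 §1.4), so «K' neat» = `Elementwise 𝓛.neat K'`; «of finite index» =
`Subgroup.FiniteIndex` of K' in K. Consumed ONLY by `B5_main_neat` (the neat sentence of TIER4 Theorem B5.1(i));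
`B5_main` does not consume it] [quote-audit: QA-t6lit-13] -/
def UllmoYafaev2014_neatInside (𝓛 : LiuAlbaneseDatum K c χEF) : Prop :=
  ∀ L : OpenSubgroup 𝓛.G, IsCompact (L : Set 𝓛.G) →
    ∃ L' : OpenSubgroup 𝓛.G, IsCompact (L' : Set 𝓛.G) ∧ L' ≤ L ∧
      ((L' : Subgroup 𝓛.G).subgroupOf (L : Subgroup 𝓛.G)).FiniteIndex ∧
        Elementwise 𝓛.neat (L' : Subgroup 𝓛.G)

#check @Liu2021_Def4_11
#check @UllmoYafaev2014_neatInside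

end Summit.Ventures.HodgeRepro2.T6.Hyp
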